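import Summits.ValiantsHypothesis.ValiantsHypothesis.Theorems.KPlusLogSqLawOctaveNewtonCellsHeight

/-!
# Route «KPlusLogSqLaw», octave door — line «newton-cells», part 3: t-FREE ROOT CONFINEMENT and «eight octaves per Newton cell» (sorry-free)

HONEST FRAMING.  Helper file `--supports stmt-ValiantsHypothesis-19561` (crux `WeakLifting`, OPEN), line «newton-cells» (val-idea-1 g4).  A sharper
octave–Newton dictionary (STRUCTURE for the octave door); it asserts no candidate law and proves nothing about `NewtonCellLifting`,
`OctaveWeakLifting`, `WeakLifting`, `TropicalB` or Conjecture B (all OPEN); VP ≠ VNP is not moved.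

* `exists_scaled_partner` (scaled pigeonhole): at a nonzero real root EVERY live exponent `e₀` has a partner `e₁ ≠ e₀` with
  `|c_{e₀} x^{e₀}| ≤ 2^{|e₁−e₀|+1} · |c_{e₁} x^{e₁}|` — because the weights `2^{−(|e−e₀|+1)}`, `e ≠ e₀`, sum to at most `1`
  (`sum_half_pow_dist_le`); no dependence on the number of terms.
* `exists_break_near` (scaled envelope gap): a top exponent at `θ` with a partner of slope difference `Δ` within `c·Δ` forces a TRUE Newton
  breakpoint within distance `c` of `θ` (`exists_break_right` / `exists_break_left`).
* `root_near_newtonBreaks_two`: every nonzero real root has `log₂|x|` within `2` of a true Newton breakpoint (the landed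
  `root_near_newtonBreaks` gives `⌊log₂ t⌋ + 1`, `t` = number of terms).
* `octaveCount_le_six_mul_card_newtonBreaks : Ω(f) ≤ 6 · #newtonBreaks f`, `octaveCount_le_eight_mul_card_newtonCells : Ω(f) ≤ 8 · #newtonCells f`,
  `octaveCount_pencilDet_le_eight_mul` (no format factor), `octaveCount_le_of_height_sharp : Ω(f) ≤ 8(2⌊√(2h)⌋+2)` for coefficients in `[A, A·2^h]`.

References (background only; everything below is elementary and self-contained): A. Ostrowski, "Recherches sur la méthode de Graeffe et les zéros des
polynômes et des séries de Laurent", Acta Math. 72 (1940) — moduli of roots vs. slopes of the Newton polygon (inclusion radii with universal constants);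
G. Malajovich, J. Zubelli, "On the geometry of Graeffe iteration", J. Complexity 17 (2001). [folklore]
-/

set_option linter.dupNamespace false
set_option autoImplicit false

namespace Summit.ValiantsHypothesis.ValiantsHypothesis.Theorems.KPlusLogSqLaw.Octave

open Polynomial Finset
open scoped BigOperators

/-! ### a finite piece of the geometric series -/

/-- `Σ_{k ∈ D} (1/2)^(k+2) ≤ 1/2`. [folklore] -/
theorem sum_half_pow_add_two_le (D : Finset ℕ) : ∑ k ∈ D, (1 / 2 : ℝ) ^ (k + 2) ≤ 1 / 2 := by
  have hs : Summable (fun k : ℕ => (1 / 4 : ℝ) * (1 / 2) ^ k) := summable_geometric_two.mul_left _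
  have h1 : ∑ k ∈ D, (1 / 2 : ℝ) ^ (k + 2) = ∑ k ∈ D, (1 / 4 : ℝ) * (1 / 2) ^ k := by
    refine sum_congr rfl fun k _ => ?_
    rw [pow_add]; ring
  rw [h1]
  calc ∑ k ∈ D, (1 / 4 : ℝ) * (1 / 2) ^ k ≤ ∑' k, (1 / 4 : ℝ) * (1 / 2) ^ k :=
        hs.sum_le_tsum D (fun k _ => by positivity)
    _ = 1 / 4 * 2 := by rw [tsum_mul_left, tsum_geometric_two]
    _ = 1 / 2 := by norm_num

/-- the SCALED weights sum to at most one: `Σ_{e ∈ T} (1/2)^(|e − e₀| + 1) ≤ 1` for a finite set of exponents `T ∌ e₀`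
(`|e − e₀|` written as `(e − e₀) + (e₀ − e)` in truncated arithmetic). [folklore] -/
theorem sum_half_pow_dist_le (T : Finset ℕ) (e₀ : ℕ) (h : e₀ ∉ T) :
    ∑ e ∈ T, (1 / 2 : ℝ) ^ (e - e₀ + (e₀ - e) + 1) ≤ 1 := by
  classical
  set U := T.filter (fun e => e₀ < e) with hU
  set L := T.filter (fun e => ¬ e₀ < e) with hL
  have hsplit := (sum_filter_add_sum_filter_not T (fun e => e₀ < e) (fun e => (1 / 2 : ℝ) ^ (e - e₀ + (e₀ - e) + 1))).symm
  rw [hsplit]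
  -- upper part, reindexed by `k = e - e₀ - 1`
  have hUsum : ∑ e ∈ U, (1 / 2 : ℝ) ^ (e - e₀ + (e₀ - e) + 1) = ∑ e ∈ U, (1 / 2 : ℝ) ^ ((e - e₀ - 1) + 2) := by
    refine sum_congr rfl fun e he => ?_
    have he' : e₀ < e := (mem_filter.1 he).2
    congr 1; omega
  have hUinj : ∀ a ∈ U, ∀ b ∈ U, a - e₀ - 1 = b - e₀ - 1 → a = b := by
    intro a ha b hb hab
    have ha' : e₀ < a := (mem_filter.1 ha).2
    have hb' : e₀ < b := (mem_filter.1 hb).2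
    omega
  have hU1 : ∑ e ∈ U, (1 / 2 : ℝ) ^ (e - e₀ + (e₀ - e) + 1) ≤ 1 / 2 := by
    rw [hUsum, ← sum_image (g := fun e => e - e₀ - 1) (f := fun k => (1 / 2 : ℝ) ^ (k + 2)) hUinj]
    exact sum_half_pow_add_two_le _
  -- lower part, reindexed by `k = e₀ - e - 1`
  have hLlt : ∀ e ∈ L, e < e₀ := by
    intro e he
    have h1 : e ∈ T := (mem_filter.1 he).1
    have h2 : ¬ e₀ < e := (mem_filter.1 he).2
    have h3 : e ≠ e₀ := fun h' => h (h' ▸ h1)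
    omega
  have hLsum : ∑ e ∈ L, (1 / 2 : ℝ) ^ (e - e₀ + (e₀ - e) + 1) = ∑ e ∈ L, (1 / 2 : ℝ) ^ ((e₀ - e - 1) + 2) := by
    refine sum_congr rfl fun e he => ?_
    have he' := hLlt e he
    congr 1; omega
  have hLinj : ∀ a ∈ L, ∀ b ∈ L, e₀ - a - 1 = e₀ - b - 1 → a = b := by
    intro a ha b hb hab
    have ha' := hLlt a ha
    have hb' := hLlt b hb
    omega
  have hL1 : ∑ e ∈ L, (1 / 2 : ℝ) ^ (e - e₀ + (e₀ - e) + 1) ≤ 1 / 2 := by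
    rw [hLsum, ← sum_image (g := fun e => e₀ - e - 1) (f := fun k => (1 / 2 : ℝ) ^ (k + 2)) hLinj]
    exact sum_half_pow_add_two_le _
  linarith

/-! ### scaled pigeonhole at a root -/

/-- **scaled pigeonhole at a root.**  At a nonzero real root, EVERY live exponent `e₀` has a partner `e₁ ≠ e₀` whose term is at least
`2^{-(|e₁−e₀|+1)}` times the `e₀`-term — independent of the number of terms (the weights `2^{-(|e−e₀|+1)}` over `e ≠ e₀` sum to
at most `1`). [folklore] -/
theorem exists_scaled_partner (p : ℝ[X]) (x : ℝ) (hx0 : x ≠ 0) (hroot : p.IsRoot x) (e₀ : ℕ) (he₀ : e₀ ∈ p.support) :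
    ∃ e₁ ∈ p.support, e₁ ≠ e₀ ∧
      |p.coeff e₀| * |x| ^ e₀ ≤ (2 : ℝ) ^ (e₁ - e₀ + (e₀ - e₁) + 1) * (|p.coeff e₁| * |x| ^ e₁) := by
  classical
  set w : ℕ → ℝ := fun e => |p.coeff e| * |x| ^ e with hw
  have hw_eq : ∀ e, w e = |p.coeff e * x ^ e| := fun e => by rw [hw]; simp [abs_mul, abs_pow]
  have hy : 0 < |x| := abs_pos.2 hx0
  have hw0 : 0 < w e₀ := mul_pos (abs_pos.2 (Polynomial.mem_support_iff.1 he₀)) (pow_pos hy _)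
  -- the root equation, split at `e₀`
  have heval : ∑ e ∈ p.support, p.coeff e * x ^ e = 0 := by
    have h1 : p.eval x = ∑ e ∈ p.support, p.coeff e * x ^ e := by rw [Polynomial.eval_eq_sum, Polynomial.sum_def]
    rw [← h1]; exact hroot
  set T := p.support.erase e₀ with hT
  have hT0 : e₀ ∉ T := by simp [hT]
  have hsplit : p.coeff e₀ * x ^ e₀ + ∑ e ∈ T, p.coeff e * x ^ e = 0 := by
    rw [hT, add_sum_erase p.support (fun e => p.coeff e * x ^ e) he₀]; exact heval
  have hle : w e₀ ≤ ∑ e ∈ T, w e := by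
    have h1 : p.coeff e₀ * x ^ e₀ = -∑ e ∈ T, p.coeff e * x ^ e := by linarith
    rw [hw_eq, h1, abs_neg]
    refine (abs_sum_le_sum_abs _ _).trans (le_of_eq ?_)
    exact sum_congr rfl fun e _ => (hw_eq e).symm
  by_contra H
  push Not at H
  -- every other term is SMALL: `w e < w e₀ · (1/2)^(|e−e₀|+1)`
  have hsmall : ∀ e ∈ T, w e < w e₀ * (1 / 2 : ℝ) ^ (e - e₀ + (e₀ - e) + 1) := by
    intro e he
    have heT : e ∈ p.support := mem_of_mem_erase he
    have hne : e ≠ e₀ := ne_of_mem_erase he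
    have h1 := H e heT hne
    have hpow : (0 : ℝ) < (1 / 2 : ℝ) ^ (e - e₀ + (e₀ - e) + 1) := by positivity
    have hone : (1 / 2 : ℝ) ^ (e - e₀ + (e₀ - e) + 1) * (2 : ℝ) ^ (e - e₀ + (e₀ - e) + 1) = 1 := by
      rw [← mul_pow]; norm_num
    calc w e = (1 / 2 : ℝ) ^ (e - e₀ + (e₀ - e) + 1) * ((2 : ℝ) ^ (e - e₀ + (e₀ - e) + 1) * w e) := by
          rw [← mul_assoc, hone, one_mul]
      _ < (1 / 2 : ℝ) ^ (e - e₀ + (e₀ - e) + 1) * w e₀ := mul_lt_mul_of_pos_left h1 hpow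
      _ = w e₀ * (1 / 2 : ℝ) ^ (e - e₀ + (e₀ - e) + 1) := mul_comm _ _
  rcases T.eq_empty_or_nonempty with hTe | hTne
  · rw [hTe, sum_empty] at hle
    linarith
  · have hlt : ∑ e ∈ T, w e < ∑ e ∈ T, w e₀ * (1 / 2 : ℝ) ^ (e - e₀ + (e₀ - e) + 1) :=
      sum_lt_sum_of_nonempty hTne hsmall
    rw [← mul_sum] at hlt
    have hsum1 := sum_half_pow_dist_le T e₀ hT0
    have : w e₀ * ∑ e ∈ T, (1 / 2 : ℝ) ^ (e - e₀ + (e₀ - e) + 1) ≤ w e₀ * 1 := mul_le_mul_of_nonneg_left hsum1 hw0.le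
    linarith

/-! ### scaled envelope gap: a breakpoint within `c` -/

/-- right-moving scaled envelope gap: if `e₀` is a top exponent at `θ` and a LARGER exponent `e₁` is within `c·(e₁−e₀)` below it,
the true Newton polygon has a breakpoint in `[θ, θ + c]`. [folklore] -/
theorem exists_break_right (p : ℝ[X]) (θ c : ℝ) (e₀ e₁ : ℕ) (he₀ : e₀ ∈ p.support) (he₁ : e₁ ∈ p.support) (hlt : e₀ < e₁)
    (htop : ∀ t ∈ p.support, newtonLog p t + t * θ ≤ newtonLog p e₀ + e₀ * θ)
    (hnear : newtonLog p e₀ + e₀ * θ ≤ newtonLog p e₁ + e₁ * θ + c * ((e₁ : ℝ) - e₀)) :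
    ∃ b ∈ newtonBreaks p, θ ≤ b ∧ b ≤ θ + c := by
  classical
  set R := p.support.filter (fun k => e₀ < k) with hR
  have he₁R : e₁ ∈ R := mem_filter.2 ⟨he₁, hlt⟩
  obtain ⟨k₀, hk₀R, hmin⟩ := exists_min_image R (fun k => newtonCross p (e₀, k)) ⟨e₁, he₁R⟩
  have hk₀ : e₀ < k₀ := (mem_filter.1 hk₀R).2
  have hk₀s : k₀ ∈ p.support := (mem_filter.1 hk₀R).1
  have hden : ∀ k : ℕ, e₀ < k → (0 : ℝ) < (k : ℝ) - e₀ := fun k hk => by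
    have : (e₀ : ℝ) < k := by exact_mod_cast hk
    linarith
  have hcross_eq : ∀ k : ℕ, newtonCross p (e₀, k) = (newtonLog p e₀ - newtonLog p k) / ((k : ℝ) - e₀) := fun k => rfl
  -- every crossing with a larger exponent lies to the right of θ
  have hcross_ge : ∀ k ∈ R, θ ≤ newtonCross p (e₀, k) := by
    intro k hk
    have hk' : e₀ < k := (mem_filter.1 hk).2
    rw [hcross_eq, le_div_iff₀ (hden k hk')]
    have := htop k (mem_filter.1 hk).1
    linarith
  set b := newtonCross p (e₀, k₀) with hb
  refine ⟨b, ?_, hcross_ge k₀ hk₀R, ?_⟩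
  · rw [newtonBreaks, mem_image]
    refine ⟨(e₀, k₀), mem_filter.2 ⟨mem_product.2 ⟨he₀, hk₀s⟩, hk₀.ne, fun t ht => ?_⟩, rfl⟩
    show newtonLog p t + t * b ≤ newtonLog p e₀ + e₀ * b
    by_cases hte : e₀ < t
    · have h1 : b ≤ newtonCross p (e₀, t) := hmin t (mem_filter.2 ⟨ht, hte⟩)
      rw [hcross_eq t, le_div_iff₀ (hden t hte)] at h1
      linarith
    · push Not at hte
      have hte' : (t : ℝ) ≤ e₀ := by exact_mod_cast hte
      have hθb : θ ≤ b := hcross_ge k₀ hk₀R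
      have h1 := htop t ht
      have h2 : (t : ℝ) * (b - θ) ≤ e₀ * (b - θ) := mul_le_mul_of_nonneg_right hte' (by linarith)
      linarith
  · have h1 : b ≤ newtonCross p (e₀, e₁) := hmin e₁ he₁R
    have h2 : newtonCross p (e₀, e₁) ≤ θ + c := by
      rw [hcross_eq, div_le_iff₀ (hden e₁ hlt)]
      linarith
    linarith

/-- left-moving scaled envelope gap (mirror image). [folklore] -/
theorem exists_break_left (p : ℝ[X]) (θ c : ℝ) (e₀ e₁ : ℕ) (he₀ : e₀ ∈ p.support) (he₁ : e₁ ∈ p.support) (hlt : e₁ < e₀)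
    (htop : ∀ t ∈ p.support, newtonLog p t + t * θ ≤ newtonLog p e₀ + e₀ * θ)
    (hnear : newtonLog p e₀ + e₀ * θ ≤ newtonLog p e₁ + e₁ * θ + c * ((e₀ : ℝ) - e₁)) :
    ∃ b ∈ newtonBreaks p, θ - c ≤ b ∧ b ≤ θ := by
  classical
  set R := p.support.filter (fun k => k < e₀) with hR
  have he₁R : e₁ ∈ R := mem_filter.2 ⟨he₁, hlt⟩
  obtain ⟨k₀, hk₀R, hmax⟩ := exists_max_image R (fun k => newtonCross p (k, e₀)) ⟨e₁, he₁R⟩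
  have hk₀ : k₀ < e₀ := (mem_filter.1 hk₀R).2
  have hk₀s : k₀ ∈ p.support := (mem_filter.1 hk₀R).1
  have hden : ∀ k : ℕ, k < e₀ → (0 : ℝ) < (e₀ : ℝ) - k := fun k hk => by
    have : (k : ℝ) < e₀ := by exact_mod_cast hk
    linarith
  have hcross_eq : ∀ k : ℕ, newtonCross p (k, e₀) = (newtonLog p k - newtonLog p e₀) / ((e₀ : ℝ) - k) := fun k => rfl
  -- every crossing with a smaller exponent lies to the left of θ
  have hcross_le : ∀ k ∈ R, newtonCross p (k, e₀) ≤ θ := by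
    intro k hk
    have hk' : k < e₀ := (mem_filter.1 hk).2
    rw [hcross_eq, div_le_iff₀ (hden k hk')]
    have := htop k (mem_filter.1 hk).1
    linarith
  set b := newtonCross p (k₀, e₀) with hb
  have htie : newtonLog p k₀ + k₀ * b = newtonLog p e₀ + e₀ * b := by
    have hne : (e₀ : ℝ) - k₀ ≠ 0 := (hden k₀ hk₀).ne'
    have : b * ((e₀ : ℝ) - k₀) = newtonLog p k₀ - newtonLog p e₀ := by rw [hb, hcross_eq]; exact div_mul_cancel₀ _ hne
    linarith
  refine ⟨b, ?_, ?_, hcross_le k₀ hk₀R⟩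
  · rw [newtonBreaks, mem_image]
    refine ⟨(k₀, e₀), mem_filter.2 ⟨mem_product.2 ⟨hk₀s, he₀⟩, hk₀.ne, fun t ht => ?_⟩, rfl⟩
    show newtonLog p t + t * b ≤ newtonLog p k₀ + k₀ * b
    rw [htie]
    by_cases hte : t < e₀
    · have h1 : newtonCross p (t, e₀) ≤ b := hmax t (mem_filter.2 ⟨ht, hte⟩)
      rw [hcross_eq t, div_le_iff₀ (hden t hte)] at h1
      linarith
    · push Not at hte
      have hte' : (e₀ : ℝ) ≤ t := by exact_mod_cast hte
      have hθb : b ≤ θ := hcross_le k₀ hk₀R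
      have h1 := htop t ht
      have h2 : (e₀ : ℝ) * (θ - b) ≤ t * (θ - b) := mul_le_mul_of_nonneg_right hte' (by linarith)
      linarith
  · have h1 : newtonCross p (e₁, e₀) ≤ b := hmax e₁ he₁R
    have h2 : θ - c ≤ newtonCross p (e₁, e₀) := by
      rw [hcross_eq, le_div_iff₀ (hden e₁ hlt)]
      linarith
    linarith

/-- **scaled envelope gap**: a top exponent `e₀` at `θ` with a partner `e₁ ≠ e₀` within `c·|e₁ − e₀|` forces a TRUE Newton breakpoint
within distance `c` of `θ` (the gap to a line of slope difference `Δ` closes at rate `Δ`). [folklore] -/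
theorem exists_break_near (p : ℝ[X]) (θ c : ℝ) (e₀ e₁ : ℕ) (he₀ : e₀ ∈ p.support) (he₁ : e₁ ∈ p.support) (hne : e₁ ≠ e₀)
    (htop : ∀ t ∈ p.support, newtonLog p t + t * θ ≤ newtonLog p e₀ + e₀ * θ)
    (hnear : newtonLog p e₀ + e₀ * θ ≤ newtonLog p e₁ + e₁ * θ + c * |(e₁ : ℝ) - e₀|) :
    ∃ b ∈ newtonBreaks p, |θ - b| ≤ c := by
  rcases lt_or_gt_of_ne hne with h | h
  · have hlt' : (e₁ : ℝ) < e₀ := by exact_mod_cast h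
    have habs : |(e₁ : ℝ) - e₀| = (e₀ : ℝ) - e₁ := by
      rw [abs_of_neg (by linarith)]; ring
    rw [habs] at hnear
    obtain ⟨b, hb, h1, h2⟩ := exists_break_left p θ c e₀ e₁ he₀ he₁ h htop hnear
    exact ⟨b, hb, by rw [abs_le]; constructor <;> linarith⟩
  · have hlt' : (e₀ : ℝ) < e₁ := by exact_mod_cast h
    have habs : |(e₁ : ℝ) - e₀| = (e₁ : ℝ) - e₀ := abs_of_pos (by linarith)
    rw [habs] at hnear
    obtain ⟨b, hb, h1, h2⟩ := exists_break_right p θ c e₀ e₁ he₀ he₁ h htop hnear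
    exact ⟨b, hb, by rw [abs_le]; constructor <;> linarith⟩

/-! ### the t-free confinement theorem and its octave corollaries -/

/-- **t-FREE ROOT CONFINEMENT**: every nonzero real root of a nonzero real polynomial has `log₂|x|` within distance `2` of a breakpoint
of its TRUE archimedean Newton polygon — independently of the number of terms (compare `root_near_newtonBreaks`: `⌊log₂ t⌋ + 1`).
Proof: scaled pigeonhole (`exists_scaled_partner`: a partner within `|e₁−e₀|+1 ≤ 2|e₁−e₀|` octaves of the top term) + scaled
envelope gap (`exists_break_near`). [folklore] -/
theorem root_near_newtonBreaks_two (p : ℝ[X]) (x : ℝ) (hx0 : x ≠ 0) (hp : p ≠ 0) (hroot : p.IsRoot x) :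
    ∃ b ∈ newtonBreaks p, |Real.logb 2 |x| - b| ≤ 2 := by
  classical
  set y := |x| with hy_def
  have hy : 0 < y := abs_pos.2 hx0
  set θ := Real.logb 2 y with hθ
  set w : ℕ → ℝ := fun e => |p.coeff e| * y ^ e with hw
  have hwpos : ∀ e ∈ p.support, 0 < w e := fun e he =>
    mul_pos (abs_pos.2 (Polynomial.mem_support_iff.1 he)) (pow_pos hy _)
  have hlog : ∀ e ∈ p.support, Real.logb 2 (w e) = newtonLog p e + e * θ := by
    intro e he
    have h1 : (0 : ℝ) < |p.coeff e| := abs_pos.2 (Polynomial.mem_support_iff.1 he)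
    rw [hw]
    show Real.logb 2 (|p.coeff e| * y ^ e) = newtonLog p e + e * θ
    rw [Real.logb_mul h1.ne' (pow_ne_zero _ hy.ne'), Real.logb_pow, newtonLog]
  obtain ⟨e', he'⟩ : p.support.Nonempty := Polynomial.support_nonempty.2 hp
  obtain ⟨e₀, he₀, hmax⟩ := exists_max_image p.support w ⟨e', he'⟩
  have htop : ∀ t ∈ p.support, newtonLog p t + t * θ ≤ newtonLog p e₀ + e₀ * θ := by
    intro t ht
    rw [← hlog t ht, ← hlog e₀ he₀]
    exact Real.logb_le_logb_of_le (by norm_num) (hwpos t ht) (hmax t ht)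
  obtain ⟨e₁, he₁, hne, hconf⟩ := exists_scaled_partner p x hx0 hroot e₀ he₀
  set D : ℕ := e₁ - e₀ + (e₀ - e₁) with hD
  have hD1 : 1 ≤ D := by rcases lt_or_gt_of_ne hne with h | h <;> omega
  have hDabs : (D : ℝ) = |(e₁ : ℝ) - e₀| := by
    rcases lt_or_gt_of_ne hne with h | h
    · have h1 : D = e₀ - e₁ := by omega
      have h2 : (e₁ : ℝ) ≤ e₀ := by exact_mod_cast h.le
      rw [h1, Nat.cast_sub h.le, abs_of_nonpos (by linarith)]; ring
    · have h1 : D = e₁ - e₀ := by omega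
      have h2 : (e₀ : ℝ) ≤ e₁ := by exact_mod_cast h.le
      rw [h1, Nat.cast_sub h.le, abs_of_nonneg (by linarith)]
  have hnear : newtonLog p e₀ + e₀ * θ ≤ newtonLog p e₁ + e₁ * θ + 2 * |(e₁ : ℝ) - e₀| := by
    have h1 := Real.logb_le_logb_of_le (b := 2) (by norm_num) (hwpos e₀ he₀) hconf
    have h2 : Real.logb 2 ((2 : ℝ) ^ (D + 1) * w e₁) = ((D + 1 : ℕ) : ℝ) + Real.logb 2 (w e₁) := by
      rw [Real.logb_mul (by positivity) (hwpos e₁ he₁).ne', Real.logb_pow, Real.logb_self_eq_one (by norm_num), mul_one]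
    rw [h2, hlog e₁ he₁] at h1
    rw [hlog e₀ he₀] at h1
    have h3 : ((D + 1 : ℕ) : ℝ) ≤ 2 * |(e₁ : ℝ) - e₀| := by
      rw [← hDabs]; push_cast
      have : (1 : ℝ) ≤ D := by exact_mod_cast hD1
      linarith
    linarith
  exact exists_break_near p θ 2 e₀ e₁ he₀ he₁ hne htop hnear

/-- **six octaves per true Newton vertex**: `Ω(f) ≤ 6 · #newtonBreaks f` for every real polynomial (t-free sharpening of
`octaveCount_le_newtonBreaks`). [folklore] -/
theorem octaveCount_le_six_mul_card_newtonBreaks (p : ℝ[X]) : octaveCount p ≤ 6 * (newtonBreaks p).card := by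
  have h := cellCount_proof p (newtonBreaks p) 2 (fun x hx hp hr => by
    simpa using root_near_newtonBreaks_two p x hx hp hr)
  simpa using h

/-- every nonzero real root is within `3` of the centre of a Newton cell (t-free). [folklore] -/
theorem root_near_newtonCells_three (p : ℝ[X]) (x : ℝ) (hx0 : x ≠ 0) (hp : p ≠ 0) (hroot : p.IsRoot x) :
    ∃ b ∈ (newtonCells p).image (fun c : ℤ => (c : ℝ) + 1 / 2), |Real.logb 2 |x| - b| ≤ ((3 : ℕ) : ℝ) := by
  obtain ⟨b, hb, hdist⟩ := root_near_newtonBreaks_two p x hx0 hp hroot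
  refine ⟨((⌊b⌋ : ℤ) : ℝ) + 1 / 2, mem_image.2 ⟨⌊b⌋, mem_image.2 ⟨b, hb, rfl⟩, rfl⟩, ?_⟩
  have h1 : ((⌊b⌋ : ℤ) : ℝ) ≤ b := Int.floor_le b
  have h2 : b < ((⌊b⌋ : ℤ) : ℝ) + 1 := Int.lt_floor_add_one b
  have h3 : |b - (((⌊b⌋ : ℤ) : ℝ) + 1 / 2)| ≤ 1 / 2 := by rw [abs_le]; constructor <;> linarith
  calc |Real.logb 2 |x| - (((⌊b⌋ : ℤ) : ℝ) + 1 / 2)|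
      ≤ |Real.logb 2 |x| - b| + |b - (((⌊b⌋ : ℤ) : ℝ) + 1 / 2)| := abs_sub_le _ _ _
    _ ≤ 2 + 1 / 2 := add_le_add hdist h3
    _ ≤ ((3 : ℕ) : ℝ) := by norm_num

/-- **EIGHT OCTAVES PER NEWTON CELL**: `Ω(f) ≤ 8 · #newtonCells f` for every real polynomial — term-count-free, coefficient-free,
design-free (sharpens `octaveCount_le_newtonCells`). [folklore] -/
theorem octaveCount_le_eight_mul_card_newtonCells (p : ℝ[X]) : octaveCount p ≤ 8 * (newtonCells p).card :=
  (cellCount_proof p ((newtonCells p).image (fun c : ℤ => (c : ℝ) + 1 / 2)) 3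
      (fun x hx hp hr => root_near_newtonCells_three p x hx hp hr)).trans
    (by simpa using Nat.mul_le_mul_left 8 (card_image_le (s := newtonCells p) (f := fun c : ℤ => (c : ℝ) + 1 / 2)))

variable {m K : ℕ} in
/-- **R1♯ for pencils, FORMAT-FREE**: `Ω(det F) ≤ 8 · V₁(det F)` — no term-count / format factor at all. [folklore] -/
theorem octaveCount_pencilDet_le_eight_mul (d : Fin K → ℕ) (S : Fin K → Matrix (Fin m) (Fin m) ℝ) :
    octaveCount (pencilDet d S) ≤ 8 * (newtonCells (pencilDet d S)).card :=
  octaveCount_le_eight_mul_card_newtonCells _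

/-- **octaves from height alone, t-free**: if the nonzero coefficients of `f` lie in `[A, A·2^h]` then `f` has nonzero real roots in at
most `8·(2⌊√(2h)⌋+2)` dyadic octaves — independently of the degree and of the number of terms (`card_newtonCells_le_of_height` +
`octaveCount_le_eight_mul_card_newtonCells`). [folklore] -/
theorem octaveCount_le_of_height_sharp (p : ℝ[X]) (A : ℝ) (hA : 0 < A) (h : ℕ)
    (hlo : ∀ e ∈ p.support, A ≤ |p.coeff e|) (hhi : ∀ e ∈ p.support, |p.coeff e| ≤ A * 2 ^ h) :
    octaveCount p ≤ 8 * (2 * Nat.sqrt (2 * h) + 2) :=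
  (octaveCount_le_eight_mul_card_newtonCells p).trans (Nat.mul_le_mul_left _ (card_newtonCells_le_of_height p A hA h hlo hhi))

end Summit.ValiantsHypothesis.ValiantsHypothesis.Theorems.KPlusLogSqLaw.Octave
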